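import Literature.MathematicalPhysics.QuantumFieldTheory.Balaban1983to89.B3Ineq211RegularBox

/-!
# Bałaban, *(Higgs)₂,₃ quantum fields in a finite volume III* [B3] — (2.10) AND (2.11) p. 426 ON THE SAME CONCRETE CARRIER FOR A
# CELL-PRODUCT BOX OF BIG BLOCKS `Ω ⊆ T_η` AT A REGULAR NON-CONSTANT BACKGROUND, EVERY POINT / EVERY PAIR OF BONDS OF THE BOX (no `R₀`):
# the decls of record `ScaledKernels.Ineq210 δ₁ C` and `ScaledKernels.Ineq211At α δ₁ C` DISCHARGED for `regBoxKernelsH`, one parameter set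

statement-level skeleton of published theorems with citation tags; proofs where landed; nothing here is a claim about the Yang–Mills mass gap

T. Bałaban, Commun. Math. Phys. **88** (1983) 411–445 [cite: Balaban1983Higgs3]; part I, Commun. Math. Phys. **85** (1982) 603–636
[cite: Balaban1982Higgs1].  PDF held: `paper:balaban1983-higgs-2-3-quantum-fields-finite-volume` p. 426 [PDF 16];
`paper:balaban1982-cmp85-higgs23-i` pp. 610–611 [PDF 8–9].

CITATION HEADER (lean-in-tree rule).  Cell `lit-balaban`, Phase-2 proof seat **p35** gen 21 (unit `lit-balaban-p35`); SKELETON rows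
**B3.Eq2.10** / **B3.Eq2.11** (fold owner r15; decls of record `ScaledKernels.Ineq210`, `ScaledKernels.Ineq211At`; LOCATED MEMBERS, no head
claim).  The carrier companion of this seat's explicit box members `B3Ineq210RegularBox.pieceR_box_bounds_small` (p346902) and
`B3Ineq211RegularBox.holder_pieceR_box_bounds_small` (p351344), exactly as `B3Ineq211RegularRegion.regRegionKernelsH` /
`ineq210_and_211At_regularRegionH_small` are for regions at interior points.  USED BY NAME, never restated: those, the box carrier
`B3Ineq210RegularBox.regBoxKernels` with its transfer `ineq210_of_boundsB`, `holderTermR`/`holderTermR_le_unif`/`IsAdm`/`one_le_tdist_of_ne'`,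
the weakening lemmas `ineq210_weaken`/`ineq211At_weaken`.

## What is printed (p. 426 [PDF 16], verbatim)

*«|G^η_{(j)}(Ω, B̃; x, x′)| ≤ O(1)(L^jη)^{−d+2}e^{−δ₁(L^jη)^{−1}|x−x′|}, (2.10) … |(δ_α G^η_{(j)}(Ω, B̃))(x₁, x₂; x)| ≤
O(1)(L^jη)^{−d+1−α}e^{−δ₁(L^jη)^{−1}min{|x₁−x|,|x₂−x|}} (2.11)»*; [Balaban1982Higgs1] p. 611 l.1–2: *«For some simple sets Ω, e.g. for rectangular
parallelepipeds, the inequalities hold without any restrictions on the points x, x′.»*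

## What this file proves, and how

`regBoxKernelsH _ C S A m² a k K₀` = `regBoxKernels` (sites = ALL points of `Ω = cellBox k K₀ S`) with the two (2.11) fields modelled:
`holderDiff j μ x₁ x₂ x` = the supremum, over the admissible contours `Γ` from `x₁` to `x₂` (`IsAdm`) THAT STAY INSIDE `Ω`, of `holderTermR`
(the column-summed Hölder difference of the piece `j`), when both bonds `⟨x₁,x₁+εe_μ⟩, ⟨x₂,x₂+εe_μ⟩` lie in `Ω` — and `0` (nothing claimed)
at bonds leaving `Ω`, exactly as `regBoxKernels.absDG`; `dist2 x₁ x₂ x = ε·min(|x₁−x|,|x₂−x|)`.  `ineq211At_of_boundsB` transfers the weighted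
per-contour bounds of `holder_pieceR_box_bounds_small` to `Ineq211At` (`(t/L^j)^α/(εt)^α = (L^jε)^{−α}`); `ineq210_and_211At_regularBoxH_small`
joins it with `ineq210_regularBox_small` at common constants (`ineq210_weaken`, `ineq211At_weaken`).

## Honest scope

The supremum in `holderDiff` ranges over admissible contours INSIDE the box (for a pair `x₁, x₂` not joined by such a contour — possible
when a factor `S_μ` is not an interval — it is `0`: nothing claimed); bonds leaving `Ω` un-modelled; otherwise the scope of the two explicit
members (`m² > 0`, `K₀ ∣ M`, three cells a side, `L^kε ≤ 1`, one smallness parameter, every charge, every `L ≥ 2`, constants depending on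
`α` and `K₀`).  No `def … : Prop`, no new named fact (`regBoxKernelsH` is a concrete `def`); axioms standard.
-/

noncomputable section

open scoped BigOperators

namespace Literature.MathematicalPhysics.QuantumFieldTheory.Balaban1983to89.B3Ineq211RegularBoxCarrier

open HiggsLattice (ChargeData ScalarField covDeriv)
open B1Eq230FluctCov (Ix cb)
open B3Sect2StatementsPart2 (ScaledKernels)
open B1TorusCubeCover (half)
open B3Ineq210RegularTorus (mesh_eq_pow_mul)
open B3Ineq210RegularRegion (pieceR)
open B3Ineq211RegularTorus (IsAdm one_le_tdist_of_ne')
open B3Ineq211RegularRegion (holderTermR holderTermR_nonneg holderTermR_le_unif ineq210_weaken ineq211At_weaken)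
open B1Ineq225RegularBox (cellBox)
open B3Ineq210RegularBox (regBoxKernels ineq210_of_boundsB pieceR_box_bounds_small)
open B3Ineq211RegularBox (holder_pieceR_box_bounds_small)

variable {P : HiggsLattice.Params} {N : ℕ}

/-! ## §1 The carrier -/

/-- **The concrete carrier of B3 (2.10)–(2.11) on a CELL-PRODUCT BOX `Ω = cellBox k K₀ S ⊆ T_η` at a regular non-constant background
`B̃ = A`**: this seat's `regBoxKernels _ C S A m² a k K₀` (sites = all points of `Ω`; `absG`, `absDG` the kernels of the pieces (2.6) and their
covariant derivatives at bonds inside `Ω`) with the two (2.11) fields modelled — `holderDiff j μ x₁ x₂ x` = the supremum over the admissible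
contours `Γ` from `x₁` to `x₂` (`IsAdm`: nearest-neighbour, `|Γ| ≤ d|x₁−x₂|`) lying INSIDE `Ω` of
`ε^{−d}Σ_{i′}‖U(A(Γ))(D^ε_{A,μ}G^η_{(j)}(Ω,A)e_{(x,i′)})(⟨x₂,μ⟩) − (D^ε_{A,μ}G^η_{(j)}(Ω,A)e_{(x,i′)})(⟨x₁,μ⟩)‖` (`holderTermR`) when both bonds
`⟨x₁,x₁+εe_μ⟩, ⟨x₂,x₂+εe_μ⟩ ⊂ Ω`, else `0`; `dist2 x₁ x₂ x = ε·min(|x₁ − x|, |x₂ − x|)`.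
[cite: Balaban1983Higgs3, (2.6) p.424, (2.10)–(2.11) p.426] [cite: Balaban1982Higgs1, Prop. 2.1 p.610, p.611 l.1–2] -/
def regBoxKernelsH (hL1 : 1 < P.L) (C : ChargeData N) (S : Fin P.d → Finset ℕ) (A : HiggsLattice.VecField P 0)
    (msq a : ℝ) (k K₀ : ℕ) : ScaledKernels :=
  { regBoxKernels hL1 C S A msq a k K₀ with
    dist2 := fun x₁ x₂ x =>
      P.mesh 0 * min (HiggsLattice.Site.tdist x₁.1 x.1 : ℝ) (HiggsLattice.Site.tdist x₂.1 x.1 : ℝ)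
    holderDiff := fun j μ x₁ x₂ x => by
      classical
      exact if x₁.1.shift μ ∈ cellBox k K₀ S ∧ x₂.1.shift μ ∈ cellBox k K₀ S then
        ⨆ (Γ : List (HiggsLattice.Site P 0)) (_ : IsAdm x₁.1 x₂.1 Γ ∧ ∀ y ∈ Γ, y ∈ cellBox k K₀ S),
          holderTermR C (cellBox k K₀ S) A msq a k j μ x₁.1 x₂.1 x.1 Γ
      else 0 }

section CarrierBH

variable {hL1 : 1 < P.L} {C : ChargeData N} {S : Fin P.d → Finset ℕ} {A : HiggsLattice.VecField P 0} {msq a : ℝ} {k K₀ : ℕ}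

/-- (2.10) for the Hölder box carrier IS (2.10) for `regBoxKernels` (same sites, distance, scales and kernels).
[cite: Balaban1983Higgs3, (2.10) p.426] -/
theorem ineq210_iff_BH (δ₁ Cst : ℝ) :
    (regBoxKernelsH hL1 C S A msq a k K₀).Ineq210 δ₁ Cst ↔ (regBoxKernels hL1 C S A msq a k K₀).Ineq210 δ₁ Cst := Iff.rfl

/-- the carrier's `L^jη` is the model's `L^jε`. [cite: Balaban1983Higgs3, (2.11) p.426] -/
theorem scaleBH_eq (j : ℕ) : (regBoxKernelsH hL1 C S A msq a k K₀).scale j = P.mesh j := by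
  show (P.L : ℝ) ^ j * P.mesh 0 = P.mesh j
  rw [mesh_eq_pow_mul P j]

/-- The length scales are positive. [cite: Balaban1983Higgs3, (2.10) p.426] -/
theorem scaleBH_pos (j : ℕ) : 0 < (regBoxKernelsH hL1 C S A msq a k K₀).scale j := by
  rw [scaleBH_eq]; exact P.mesh_pos j

/-- The distance `ε|x − x′|` is non-negative. [cite: Balaban1983Higgs3, (2.10) p.426] -/
theorem distBH_nonneg (x x' : {x : HiggsLattice.Site P 0 // x ∈ cellBox k K₀ S}) :
    0 ≤ (regBoxKernelsH hL1 C S A msq a k K₀).dist x x' := by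
  show 0 ≤ P.mesh 0 * (HiggsLattice.Site.tdist x.1 x'.1 : ℝ)
  exact mul_nonneg (P.mesh_pos 0).le (Nat.cast_nonneg _)

/-- The distance `ε·min(|x₁ − x|, |x₂ − x|)` is non-negative. [cite: Balaban1983Higgs3, (2.11) p.426] -/
theorem dist2BH_nonneg (x₁ x₂ x : {x : HiggsLattice.Site P 0 // x ∈ cellBox k K₀ S}) :
    0 ≤ (regBoxKernelsH hL1 C S A msq a k K₀).dist2 x₁ x₂ x := by
  show 0 ≤ P.mesh 0 * min (HiggsLattice.Site.tdist x₁.1 x.1 : ℝ) (HiggsLattice.Site.tdist x₂.1 x.1 : ℝ)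
  exact mul_nonneg (P.mesh_pos 0).le (le_min (Nat.cast_nonneg _) (Nat.cast_nonneg _))

/-- the carrier's Hölder field at a pair of bonds inside the box. [cite: Balaban1983Higgs3, (2.11) p.426] -/
theorem regBoxKernelsH_holderDiff (j : ℕ) (μ : Fin P.d) (x₁ x₂ x : {x : HiggsLattice.Site P 0 // x ∈ cellBox k K₀ S})
    (h₁ : x₁.1.shift μ ∈ cellBox k K₀ S) (h₂ : x₂.1.shift μ ∈ cellBox k K₀ S) :
    (regBoxKernelsH hL1 C S A msq a k K₀).holderDiff j μ x₁ x₂ x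
      = ⨆ (Γ : List (HiggsLattice.Site P 0)) (_ : IsAdm x₁.1 x₂.1 Γ ∧ ∀ y ∈ Γ, y ∈ cellBox k K₀ S),
          holderTermR C (cellBox k K₀ S) A msq a k j μ x₁.1 x₂.1 x.1 Γ := by
  classical
  show (if x₁.1.shift μ ∈ cellBox k K₀ S ∧ x₂.1.shift μ ∈ cellBox k K₀ S then
      ⨆ (Γ : List (HiggsLattice.Site P 0)) (_ : IsAdm x₁.1 x₂.1 Γ ∧ ∀ y ∈ Γ, y ∈ cellBox k K₀ S),
        holderTermR C (cellBox k K₀ S) A msq a k j μ x₁.1 x₂.1 x.1 Γ else 0) = _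
  rw [if_pos ⟨h₁, h₂⟩]

/-- the carrier's Hölder field at a bond leaving the box is `0` (nothing claimed). [cite: Balaban1983Higgs3, (2.11) p.426] -/
theorem regBoxKernelsH_holderDiff_of_not (j : ℕ) (μ : Fin P.d) (x₁ x₂ x : {x : HiggsLattice.Site P 0 // x ∈ cellBox k K₀ S})
    (h : ¬ (x₁.1.shift μ ∈ cellBox k K₀ S ∧ x₂.1.shift μ ∈ cellBox k K₀ S)) :
    (regBoxKernelsH hL1 C S A msq a k K₀).holderDiff j μ x₁ x₂ x = 0 := by
  classical
  show (if x₁.1.shift μ ∈ cellBox k K₀ S ∧ x₂.1.shift μ ∈ cellBox k K₀ S then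
      ⨆ (Γ : List (HiggsLattice.Site P 0)) (_ : IsAdm x₁.1 x₂.1 Γ ∧ ∀ y ∈ Γ, y ∈ cellBox k K₀ S),
        holderTermR C (cellBox k K₀ S) A msq a k j μ x₁.1 x₂.1 x.1 Γ else 0) = 0
  rw [if_neg h]

/-- **Every admissible contour inside the box is dominated**: `holderTermR(Γ) ≤ holderDiff`. [cite: Balaban1983Higgs3, (2.11) p.426] -/
theorem holderTermR_le_holderDiffB (j : ℕ) (μ : Fin P.d) (x₁ x₂ x : {x : HiggsLattice.Site P 0 // x ∈ cellBox k K₀ S})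
    (h₁ : x₁.1.shift μ ∈ cellBox k K₀ S) (h₂ : x₂.1.shift μ ∈ cellBox k K₀ S)
    {Γ : List (HiggsLattice.Site P 0)} (hΓ : IsAdm x₁.1 x₂.1 Γ) (hΓΩ : ∀ y ∈ Γ, y ∈ cellBox k K₀ S) :
    holderTermR C (cellBox k K₀ S) A msq a k j μ x₁.1 x₂.1 x.1 Γ ≤ (regBoxKernelsH hL1 C S A msq a k K₀).holderDiff j μ x₁ x₂ x := by
  rw [regBoxKernelsH_holderDiff j μ x₁ x₂ x h₁ h₂]
  set U : ℝ := (P.mesh 0 ^ P.d)⁻¹ * ∑ i' : Ix N,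
      (‖covDeriv C A (pieceR C (cellBox k K₀ S) A msq a k j (cb P N 0 (x.1, i'))) ⟨x₂.1, μ⟩‖
        + ‖covDeriv C A (pieceR C (cellBox k K₀ S) A msq a k j (cb P N 0 (x.1, i'))) ⟨x₁.1, μ⟩‖) with hU
  have hU0 : 0 ≤ U := mul_nonneg (inv_nonneg.mpr (pow_nonneg (P.mesh_pos 0).le _)) (Finset.sum_nonneg fun _ _ => by positivity)
  have hbdd : BddAbove (Set.range fun Γ' : List (HiggsLattice.Site P 0) =>
      ⨆ (_ : IsAdm x₁.1 x₂.1 Γ' ∧ ∀ y ∈ Γ', y ∈ cellBox k K₀ S), holderTermR C (cellBox k K₀ S) A msq a k j μ x₁.1 x₂.1 x.1 Γ') := by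
    refine ⟨U, ?_⟩
    rintro _ ⟨Γ', rfl⟩
    exact Real.iSup_le (fun _ => holderTermR_le_unif C (cellBox k K₀ S) A msq μ x₁.1 x₂.1 x.1 Γ') hU0
  refine le_ciSup_of_le hbdd Γ ?_
  rw [ciSup_pos (⟨hΓ, hΓΩ⟩ : IsAdm x₁.1 x₂.1 Γ ∧ ∀ y ∈ Γ, y ∈ cellBox k K₀ S)]

/-- kernel: `(L^jη)^{1−d−α} = (L^jη)·((L^jη)^d)^{−1}·((L^jη)^α)^{−1}` (real exponent). [folklore] -/
private theorem rpow_one_sub_sub (j : ℕ) (α : ℝ) :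
    P.mesh j ^ ((1 : ℝ) - (P.d : ℝ) - α) = P.mesh j * (P.mesh j ^ P.d)⁻¹ * (P.mesh j ^ α)⁻¹ := by
  have hs := P.mesh_pos j
  rw [Real.rpow_sub hs, Real.rpow_sub hs, Real.rpow_one, Real.rpow_natCast _ P.d, div_eq_mul_inv, div_eq_mul_inv]

/-- kernel: `(L^jη)^{−1}·(η·m) = m/L^j`. [folklore] -/
private theorem scale_inv_mul (j : ℕ) (m : ℝ) : (P.mesh j)⁻¹ * (P.mesh 0 * m) = m / (P.L : ℝ) ^ j := by
  rw [mesh_eq_pow_mul P j, mul_inv, mul_assoc, ← mul_assoc (P.mesh 0)⁻¹, inv_mul_cancel₀ (P.mesh_pos 0).ne', one_mul,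
    div_eq_inv_mul]

/-- kernel: the weights — `(ε·t)^α·((L^jε)^α)^{−1} = (t/L^j)^α`. [folklore] -/
private theorem weight_eq (j : ℕ) {t α : ℝ} (ht : 0 ≤ t) :
    (P.mesh 0 * t) ^ α * (P.mesh j ^ α)⁻¹ = (t / (P.L : ℝ) ^ j) ^ α := by
  have hm0 : 0 < P.mesh 0 := P.mesh_pos 0
  have hmj : 0 < P.mesh j := P.mesh_pos j
  rw [← Real.inv_rpow hmj.le, ← Real.mul_rpow (mul_nonneg hm0.le ht) (inv_nonneg.mpr hmj.le)]
  congr 1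
  rw [mesh_eq_pow_mul P j, mul_inv, div_eq_mul_inv]
  calc P.mesh 0 * t * (((P.L : ℝ) ^ j)⁻¹ * (P.mesh 0)⁻¹) = t * ((P.L : ℝ) ^ j)⁻¹ * (P.mesh 0 * (P.mesh 0)⁻¹) := by ring
    _ = t * ((P.L : ℝ) ^ j)⁻¹ := by rw [mul_inv_cancel₀ hm0.ne', mul_one]

/-- **Transfer**: Hölder-weighted bounds on every admissible contour inside the box, at every pair of bonds of the box and every source, in
the model's units (the conclusion of `holder_pieceR_box_bounds_small`), give `Ineq211At` for the box carrier (`holderDiff` is the supremum;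
`|x₁ − x₂| = ε·t`, `(t/L^j)^α/(εt)^α = (L^jε)^{−α}`; bonds leaving the box: `0 ≤` the right side). [cite: Balaban1983Higgs3, (2.11) p.426] -/
theorem ineq211At_of_boundsB {α δ₁ Cst : ℝ} (hCst : 0 ≤ Cst)
    (h : ∀ (j : ℕ) (μ : Fin P.d) (x₁ x₂ x : HiggsLattice.Site P 0), x₂ ≠ x₁ →
      x₁ ∈ cellBox k K₀ S → x₁.shift μ ∈ cellBox k K₀ S → x₂ ∈ cellBox k K₀ S → x₂.shift μ ∈ cellBox k K₀ S →
      x ∈ cellBox k K₀ S → ∀ Γ : List (HiggsLattice.Site P 0), IsAdm x₁ x₂ Γ → (∀ y ∈ Γ, y ∈ cellBox k K₀ S) →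
      (((HiggsLattice.Site.tdist x₁ x₂ : ℝ) / (P.L : ℝ) ^ j)⁻¹) ^ α * holderTermR C (cellBox k K₀ S) A msq a k j μ x₁ x₂ x Γ
        ≤ Cst * (P.mesh j * (P.mesh j ^ P.d)⁻¹) *
          Real.exp (-(δ₁ * (min (HiggsLattice.Site.tdist x₁ x : ℝ) (HiggsLattice.Site.tdist x₂ x : ℝ) / (P.L : ℝ) ^ j)))) :
    (regBoxKernelsH hL1 C S A msq a k K₀).Ineq211At α δ₁ Cst := by
  intro j μ x₁ x₂ x hne
  have hne' : x₂.1 ≠ x₁.1 := fun h' => hne (Subtype.ext h'.symm)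
  have e3 : (regBoxKernelsH hL1 C S A msq a k K₀).dist x₁ x₂ = P.mesh 0 * (HiggsLattice.Site.tdist x₁.1 x₂.1 : ℝ) := rfl
  have e4 : (regBoxKernelsH hL1 C S A msq a k K₀).d = P.d := rfl
  have e5 : (regBoxKernelsH hL1 C S A msq a k K₀).dist2 x₁ x₂ x
      = P.mesh 0 * min (HiggsLattice.Site.tdist x₁.1 x.1 : ℝ) (HiggsLattice.Site.tdist x₂.1 x.1 : ℝ) := rfl
  rw [scaleBH_eq, e3, e4, e5]
  set t : ℝ := (HiggsLattice.Site.tdist x₁.1 x₂.1 : ℝ) with ht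
  set E : ℝ := Real.exp (-(δ₁ * (min (HiggsLattice.Site.tdist x₁.1 x.1 : ℝ) (HiggsLattice.Site.tdist x₂.1 x.1 : ℝ) /
    (P.L : ℝ) ^ j))) with hE
  have hm0 : 0 < P.mesh 0 := P.mesh_pos 0
  have hmj : 0 < P.mesh j := P.mesh_pos j
  have hLj : (0 : ℝ) < (P.L : ℝ) ^ j := pow_pos (by exact_mod_cast P.hL) j
  have ht1 : 1 ≤ t := by rw [ht]; exact_mod_cast one_le_tdist_of_ne' hne'
  have ht0 : 0 < t := by linarith
  have hu : 0 < t / (P.L : ℝ) ^ j := div_pos ht0 hLj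
  have hdist : 0 < (P.mesh 0 * t) ^ α := Real.rpow_pos_of_pos (mul_pos hm0 ht0) _
  have hexp : Real.exp (-(δ₁ * (P.mesh j)⁻¹ *
      (P.mesh 0 * min (HiggsLattice.Site.tdist x₁.1 x.1 : ℝ) (HiggsLattice.Site.tdist x₂.1 x.1 : ℝ)))) = E := by
    rw [hE, mul_assoc δ₁, scale_inv_mul]
  rw [hexp, div_le_iff₀ hdist]
  have hrhs : Cst * P.mesh j ^ ((1 : ℝ) - (P.d : ℝ) - α) * E * (P.mesh 0 * t) ^ α
      = Cst * (P.mesh j * (P.mesh j ^ P.d)⁻¹) * E * (t / (P.L : ℝ) ^ j) ^ α := by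
    rw [rpow_one_sub_sub, ← weight_eq j ht0.le]; ring
  rw [hrhs]
  have hB0 : 0 ≤ Cst * (P.mesh j * (P.mesh j ^ P.d)⁻¹) * E * (t / (P.L : ℝ) ^ j) ^ α := by positivity
  by_cases hb : x₁.1.shift μ ∈ cellBox k K₀ S ∧ x₂.1.shift μ ∈ cellBox k K₀ S
  · rw [regBoxKernelsH_holderDiff j μ x₁ x₂ x hb.1 hb.2]
    refine Real.iSup_le (fun Γ => Real.iSup_le (fun hΓ => ?_) hB0) hB0
    -- one admissible contour inside the box: divide the weighted bound by the weight `W = ((t/L^j)^α)^{−1}`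
    have hW : (((t / (P.L : ℝ) ^ j))⁻¹) ^ α = ((t / (P.L : ℝ) ^ j) ^ α)⁻¹ := Real.inv_rpow hu.le α
    have hWpos : 0 < (t / (P.L : ℝ) ^ j) ^ α := Real.rpow_pos_of_pos hu _
    have hh := h j μ x₁.1 x₂.1 x.1 hne' x₁.2 hb.1 x₂.2 hb.2 x.2 Γ hΓ.1 hΓ.2
    rw [← ht, hW, ← hE, inv_mul_le_iff₀ hWpos] at hh
    calc holderTermR C (cellBox k K₀ S) A msq a k j μ x₁.1 x₂.1 x.1 Γ
        ≤ (t / (P.L : ℝ) ^ j) ^ α * (Cst * (P.mesh j * (P.mesh j ^ P.d)⁻¹) * E) := hh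
      _ = _ := by ring
  · rw [regBoxKernelsH_holderDiff_of_not j μ x₁ x₂ x hb]
    exact hB0

end CarrierBH

/-! ## §2 The theorems -/

section MainBH

/-- **B3 (2.11) p. 426 [PDF 16] AT A FIXED `α` PROVED FOR THE BOX CARRIER — every pair of bonds of the box, every source, no `R₀`, one
smallness parameter, every charge.**  For `d ≥ 1`, `L ≥ 2`, `a, m² > 0`, `N` and EVERY charge there is `K₀,min` and, for every `0 ≤ α < 1` and
every `K₀ ≥ K₀,min`, constants `t, δ₁, C > 0` with: for every volume with these `d, L` and `K₀ ∣ M`, every scale `1 ≤ k ≤ K` with `L^kε ≤ 1`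
and `3L^kK₀ ≤ |T_ε|_μ`, every cell-product box `Ω = cellBox k K₀ S` and every `A` `δ_A`-regular on `Ω` with `L^kδ_A|e| ≤ t`:
`(regBoxKernelsH _ C S A m² a k K₀).Ineq211At α δ₁ C` — the decl of record of row B3.Eq2.11 discharged on boxes (from
`holder_pieceR_box_bounds_small` through `ineq211At_of_boundsB`). [cite: Balaban1983Higgs3, (2.11) p.426]
[cite: Balaban1982Higgs1, Prop. 2.1 (2.23)–(2.24) p.610, p.611 l.1–2] -/
theorem ineq211At_regularBox_small (d L : ℕ) (hd : 1 ≤ d) (hL : 2 ≤ L) {a : ℝ} (ha : 0 < a) {msq : ℝ} (hmsq : 0 < msq)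
    (N : ℕ) (C : ChargeData N) :
    ∃ K₀min : ℕ, ∀ {α : ℝ}, 0 ≤ α → α < 1 → ∀ K₀ : ℕ, K₀min ≤ K₀ → ∃ t δ₁ Cst : ℝ, 0 < t ∧ 0 < δ₁ ∧ 0 < Cst ∧
      ∀ (P : HiggsLattice.Params) (hP1 : 1 < P.L), P.d = d → P.L = L → K₀ ∣ P.M →
      ∀ {k : ℕ}, 1 ≤ k → k ≤ P.K → (∀ μ, 3 * half P k K₀ ≤ P.sitesPerDir 0 μ) → P.mesh k ≤ 1 →
      ∀ (S : Fin P.d → Finset ℕ) (A : HiggsLattice.VecField P 0) {δA : ℝ}, 0 ≤ δA →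
        (∀ z ∈ cellBox k K₀ S, ∀ μ ν : Fin P.d, |A ⟨z.shift ν, μ⟩ - A ⟨z, μ⟩| ≤ δA) →
        (P.L : ℝ) ^ k * δA * |C.e| ≤ t →
        (regBoxKernelsH hP1 C S A msq a k K₀).Ineq211At α δ₁ Cst := by
  obtain ⟨K₀min, h⟩ := holder_pieceR_box_bounds_small d L hd hL ha hmsq N C
  refine ⟨K₀min, fun {α} hα0 hα1 K₀ hK₀ => ?_⟩
  obtain ⟨t, δ₁, Cst, ht, hδ₁, hCst, h⟩ := h hα0 hα1 K₀ hK₀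
  refine ⟨t, δ₁, Cst, ht, hδ₁, hCst, ?_⟩
  intro P hP1 hPd hPL hK₀M k hk1 hkK h3 hmesh S A δA hδA hreg ht'
  exact ineq211At_of_boundsB hCst.le (h P hPd hPL hK₀M hk1 hkK h3 hmesh S A hδA hreg ht')

/-- **(2.10) AND (2.11) ON THE SAME BOX CARRIER, ONE PARAMETER SET** — for every `0 ≤ α < 1` and `K₀ ≥ K₀,min` common constants `t, δ₁, C`
with `(regBoxKernelsH _ C S A m² a k K₀).Ineq210 δ₁ C ∧ (regBoxKernelsH _ C S A m² a k K₀).Ineq211At α δ₁ C` under the hypotheses above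
(the two members' thresholds joined, `K₀,min = max`, `t = min`, their constants weakened to a common pair `δ₁ = min`, `C = max` by
`ineq210_weaken`/`ineq211At_weaken`) — the box twin of `B3Ineq211RegularRegion.ineq210_and_211At_regularRegionH_small`, at EVERY point
of the box instead of interior points. [cite: Balaban1983Higgs3, (2.6) p.424, (2.10)–(2.11) p.426] [cite: Balaban1982Higgs1, Prop. 2.1
(2.23)–(2.25) p.610, p.611 l.1–2, Prop. 2.3 (2.34) p.611, (2.43) p.612] -/
theorem ineq210_and_211At_regularBoxH_small (d L : ℕ) (hd : 1 ≤ d) (hL : 2 ≤ L) {a : ℝ} (ha : 0 < a) {msq : ℝ}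
    (hmsq : 0 < msq) (N : ℕ) (C : ChargeData N) :
    ∃ K₀min : ℕ, ∀ {α : ℝ}, 0 ≤ α → α < 1 → ∀ K₀ : ℕ, K₀min ≤ K₀ → ∃ t δ₁ Cst : ℝ, 0 < t ∧ 0 < δ₁ ∧ 0 < Cst ∧
      ∀ (P : HiggsLattice.Params) (hP1 : 1 < P.L), P.d = d → P.L = L → K₀ ∣ P.M →
      ∀ {k : ℕ}, 1 ≤ k → k ≤ P.K → (∀ μ, 3 * half P k K₀ ≤ P.sitesPerDir 0 μ) → P.mesh k ≤ 1 →
      ∀ (S : Fin P.d → Finset ℕ) (A : HiggsLattice.VecField P 0) {δA : ℝ}, 0 ≤ δA →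
        (∀ z ∈ cellBox k K₀ S, ∀ μ ν : Fin P.d, |A ⟨z.shift ν, μ⟩ - A ⟨z, μ⟩| ≤ δA) →
        (P.L : ℝ) ^ k * δA * |C.e| ≤ t →
        (regBoxKernelsH hP1 C S A msq a k K₀).Ineq210 δ₁ Cst ∧
          (regBoxKernelsH hP1 C S A msq a k K₀).Ineq211At α δ₁ Cst := by
  obtain ⟨K₁, h₁⟩ := pieceR_box_bounds_small d L hd hL ha hmsq N C
  obtain ⟨K₂, h₂⟩ := ineq211At_regularBox_small d L hd hL ha hmsq N C
  refine ⟨max K₁ K₂, fun {α} hα0 hα1 K₀ hK₀ => ?_⟩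
  obtain ⟨t₁, δ₁, C₁, ht₁, hδ₁, hC₁, h₁⟩ := h₁ K₀ ((le_max_left _ _).trans hK₀)
  obtain ⟨t₂, δ₂, C₂, ht₂, hδ₂, hC₂, h₂⟩ := h₂ hα0 hα1 K₀ ((le_max_right _ _).trans hK₀)
  refine ⟨min t₁ t₂, min δ₁ δ₂, max C₁ C₂, lt_min ht₁ ht₂, lt_min hδ₁ hδ₂, lt_max_of_lt_left hC₁, ?_⟩
  intro P hP1 hPd hPL hK₀M k hk1 hkK h3 hmesh S A δA hδA hreg ht
  have hA := h₁ P hP1 hPd hPL hK₀M hk1 hkK h3 hmesh S A hδA hreg (ht.trans (min_le_left _ _))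
  have hB := h₂ P hP1 hPd hPL hK₀M hk1 hkK h3 hmesh S A hδA hreg (ht.trans (min_le_right _ _))
  refine ⟨?_, ?_⟩
  · exact ineq210_weaken (regBoxKernelsH hP1 C S A msq a k K₀) (min_le_left _ _) (le_max_left _ _) hC₁.le
      scaleBH_pos distBH_nonneg ((ineq210_iff_BH δ₁ C₁).mpr (ineq210_of_boundsB hC₁.le hA))
  · exact ineq211At_weaken (regBoxKernelsH hP1 C S A msq a k K₀) (min_le_right _ _) (le_max_right _ _) hC₂.le
      scaleBH_pos dist2BH_nonneg hB

end MainBH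

end Literature.MathematicalPhysics.QuantumFieldTheory.Balaban1983to89.B3Ineq211RegularBoxCarrier

end
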